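import Summits.AtomisticToContinuum.HydrodynamicLimit.Theorems.JParityClosureLocalSecondLawLedgerObs
import Summits.AtomisticToContinuum.HydrodynamicLimit.Theorems.JParityClosureLocalSecondLawLedgerIBP

/-!
# Entropy ledger for `JParityClosure.LocalSecondLaw` — continuity of the streaming derivative
(stmt-AtomisticToContinuum-13081, line `exact-entropy-ledger-three-passivities`, layer 9 of stub L)

The second streaming hypothesis of the weak balance law: along every free flight the streaming derivative
`t ↦ F'(t, S_{t-t₀} w)` of the observable `∫ Ĥ(U_r) φ` is continuous.  Its integrand contains the field
derivative of the cone kernel `x ↦ D b(xᵢ(t) - x)·vᵢ`, which is discontinuous in `x`; but it enters as a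
convolution against a jointly continuous weight, `∫ A(t, x) κ(xᵢ(t) - x) dx = ∫ A(t, xᵢ(t) - z) κ(z) dz`
(translation and reflection invariance of the Haar measure of `𝕋³`), which is continuous in `t` by dominated
convergence (`continuous_integral_mul_kernel`).

References: H. Spohn, *Large Scale Dynamics of Interacting Particles* (1991), Part I §3.2.
-/

noncomputable section

namespace Summit.AtomisticToContinuum.HydrodynamicLimit.Theorems.LocalSecondLawLedger

open scoped BigOperators Topology ENNReal InnerProductSpace
open Filter Set MeasureTheory Metric
open Literature.MathematicalPhysics.KineticTheory
open Literature.Analysis.FluidPDE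
open Literature.Analysis.FunctionSpaces
open Summit.AtomisticToContinuum.HydrodynamicLimit.Theorems.LocalSecondLawNegative

namespace L

variable {N : ℕ}

/-- **Continuity of kernel convolutions against jointly continuous weights.** For `A` jointly continuous on
`ℝ × 𝕋³`, a continuous path `p` and a bounded measurable kernel `κ`, `t ↦ ∫ A(t, x) κ(p(t) - x) dx` is continuous.
[folklore] -/
theorem continuous_integral_mul_kernel {A : ℝ → T3 → ℝ} (hA : Continuous (Function.uncurry A)) {p : ℝ → T3}
    (hp : Continuous p) {κ : T3 → ℝ} (hκm : Measurable κ) {K : ℝ} (hκ : ∀ z, |κ z| ≤ K) :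
    Continuous fun t => ∫ x, A t x * κ (p t - x) := by
  haveI : (volume : Measure T3).IsNegInvariant := Measure.IsAddHaarMeasure.isNegInvariant_of_regular _
  have hsub : ∀ t, ∫ x, A t x * κ (p t - x) = ∫ z, A t (p t - z) * κ z := fun t => by
    have h := integral_sub_left_eq_self (fun x => A t x * κ (p t - x)) volume (p t)
    simp only [sub_sub_cancel] at h
    exact h.symm
  simp_rw [hsub]
  refine continuous_iff_continuousAt.2 fun t₀ => ?_
  have hAt : ∀ t, Continuous (A t) := fun t => hA.comp (continuous_const.prodMk continuous_id)
  obtain ⟨C, hC⟩ := (isCompact_Icc.prod isCompact_univ : IsCompact (Set.Icc (t₀ - 1) (t₀ + 1) ×ˢ (Set.univ : Set T3))).exists_bound_of_continuousOn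
    hA.continuousOn
  have hK0 : 0 ≤ K := (abs_nonneg _).trans (hκ 0)
  refine continuousAt_of_dominated (bound := fun _ => C * K) ?_ ?_ (integrable_const _) ?_
  · exact Filter.Eventually.of_forall fun t =>
      (((hAt t).comp (continuous_const.sub continuous_id)).measurable.mul hκm).aestronglyMeasurable
  · have hnear : ∀ᶠ t in 𝓝 t₀, t ∈ Set.Icc (t₀ - 1) (t₀ + 1) := Icc_mem_nhds (by linarith) (by linarith)
    filter_upwards [hnear] with t ht
    refine Filter.Eventually.of_forall fun z => ?_
    rw [Real.norm_eq_abs, abs_mul]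
    have h1 : |A t (p t - z)| ≤ C := by
      simpa [Real.norm_eq_abs] using hC (t, p t - z) ⟨ht, Set.mem_univ _⟩
    exact mul_le_mul h1 (hκ z) (abs_nonneg _) ((abs_nonneg _).trans h1)
  · exact Filter.Eventually.of_forall fun z =>
      ((hA.comp (continuous_id.prodMk (hp.sub continuous_const))).continuousAt).mul continuousAt_const

/-- Space integrals of jointly continuous weights are continuous in the parameter. [folklore] -/
theorem continuous_integral_of_uncurry {B : ℝ → T3 → ℝ} (hB : Continuous (Function.uncurry B)) :
    Continuous fun t => ∫ x, B t x := by
  have h := continuous_parametric_integral_of_continuous (μ := (volume : Measure T3)) hB isCompact_univ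
  simpa only [Measure.restrict_univ] using h

section FlightContinuity

variable {σ c η₀ η₁ r : ℝ} {F : ℝ → ℝ} (hE : EosBand η₀ F) (hη : 0 < η₁) (hη₁ : η₁ < η₀) (hσ : 0 < σ)
  (hc : 0 < c) (hr : 0 < r) {φ : ℝ → T3 → ℝ} (hφ : Torus.IsSmoothSpaceTimeOn Set.univ φ)

include hr in
/-- The conserved fields are jointly continuous in flight time and field point. [folklore] -/
theorem continuous_U_flight (w : Phase N) (t₀ : ℝ) :
    Continuous fun q : ℝ × T3 => U r (freeFlight (Torus.geometry (Fin 3)) (q.1 - t₀) w) q.2 := by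
  have hcone : ∀ i : Fin (N + 1), Continuous fun q : ℝ × T3 =>
      cone r ((w i).1 + Torus.proj ((q.1 - t₀) • (w i).2)) q.2 := by
    intro i
    have : (fun q : ℝ × T3 => cone r ((w i).1 + Torus.proj ((q.1 - t₀) • (w i).2)) q.2) =
        fun q => cone r ((w i).1 + Torus.proj ((q.1 - t₀) • (w i).2) - q.2) 0 := funext fun q => cone_eq_sub _ _ _
    rw [this]
    exact (lipschitzWith_cone_zero hr).continuous.comp ((continuous_const.add
      (Torus.continuous_proj.comp ((continuous_fst.sub continuous_const).smul continuous_const))).sub continuous_snd)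
  have hρ : Continuous fun q : ℝ × T3 => rhoC r (freeFlight (Torus.geometry (Fin 3)) (q.1 - t₀) w) q.2 := by
    simp only [rhoC_eq_sum, freeFlight_torus_fst]
    exact continuous_const.mul (continuous_finsetSum _ fun i _ => hcone i)
  have hm : Continuous fun q : ℝ × T3 => WithLp.ofLp (momC r (freeFlight (Torus.geometry (Fin 3)) (q.1 - t₀) w) q.2) := by
    refine continuous_pi fun l => ?_
    simp only [momC_apply_eq_sum, freeFlight_torus_fst, freeFlight_torus_snd]
    exact continuous_const.mul (continuous_finsetSum _ fun i _ => (hcone i).mul continuous_const)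
  have he : Continuous fun q : ℝ × T3 => kinC r (freeFlight (Torus.geometry (Fin 3)) (q.1 - t₀) w) q.2 := by
    simp only [kinC_eq_sum, freeFlight_torus_fst, freeFlight_torus_snd]
    exact continuous_const.mul (continuous_finsetSum _ fun i _ => (hcone i).mul continuous_const)
  exact hρ.prodMk (hm.prodMk he)

/-- The weight of the particle-`i` kernel term of the streaming integrand along the flight. [folklore] -/
def Aterm (σ c η₀ η₁ r : ℝ) (φ : ℝ → T3 → ℝ) (w : Phase N) (t₀ : ℝ) (i : Fin (N + 1)) (t : ℝ) (x : T3) : ℝ :=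
  ((N + 1 : ℕ) : ℝ)⁻¹ * hcoef σ c η₀ η₁ (U r (freeFlight (Torus.geometry (Fin 3)) (t - t₀) w) x) (w i).2 * φ t x

/-- The smooth term of the streaming integrand along the flight. [folklore] -/
def Bterm (σ c η₀ η₁ r : ℝ) (φ : ℝ → T3 → ℝ) (w : Phase N) (t₀ : ℝ) (t : ℝ) (x : T3) : ℝ :=
  Hhat σ c η₀ η₁ (U r (freeFlight (Torus.geometry (Fin 3)) (t - t₀) w) x) * deriv (fun s' => φ s' x) t

/-- The field derivative of the cone kernel contracted with a velocity, as a function of `y - x`. [folklore] -/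
def kker (r : ℝ) (v : V3) (z : T3) : ℝ := Torus.fderiv (fun z : T3 => cone r z 0) z v

omit hη hη₁ hσ hc hr in
/-- The streaming integrand along the flight, term by term. [folklore] -/
theorem obsDi_flight_eq (w : Phase N) (t₀ t : ℝ) (x : T3) :
    obsDi σ c η₀ η₁ r φ t (freeFlight (Torus.geometry (Fin 3)) (t - t₀) w) x =
      (∑ i, Aterm σ c η₀ η₁ r φ w t₀ i t x * kker r (w i).2 ((w i).1 + Torus.proj ((t - t₀) • (w i).2) - x))
        + Bterm σ c η₀ η₁ r φ w t₀ t x := by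
  unfold obsDi Aterm Bterm kker cg
  simp only [neg_neg, freeFlight_torus_fst, freeFlight_torus_snd, Finset.mul_sum, Finset.sum_mul]
  congr 1
  refine Finset.sum_congr rfl fun i _ => ?_
  ring

include hE hη hη₁ hσ hc hr hφ in
/-- The weights are jointly continuous. [folklore] -/
theorem continuous_Aterm (w : Phase N) (t₀ : ℝ) (i : Fin (N + 1)) :
    Continuous (Function.uncurry (Aterm σ c η₀ η₁ r φ w t₀ i)) := by
  have hH := contDiff_Hhat hE hη hη₁ hσ hc
  have hUq := continuous_U_flight hr w t₀
  have hfd : Continuous fun q : ℝ × T3 =>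
      fderiv ℝ (Hhat σ c η₀ η₁) (U r (freeFlight (Torus.geometry (Fin 3)) (q.1 - t₀) w) q.2) :=
    (hH.continuous_fderiv one_ne_zero).comp hUq
  have hco : Continuous fun q : ℝ × T3 =>
      hcoef σ c η₀ η₁ (U r (freeFlight (Torus.geometry (Fin 3)) (q.1 - t₀) w) q.2) (w i).2 := by
    unfold hcoef
    exact ((hfd.clm_apply continuous_const).add (continuous_finsetSum _ fun l _ =>
      continuous_const.mul (hfd.clm_apply continuous_const))).add
        (continuous_const.mul (hfd.clm_apply continuous_const))
  exact (continuous_const.mul hco).mul (continuous_uncurry_of_smooth hφ)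

include hE hη hη₁ hσ hc hr hφ in
/-- The smooth term is jointly continuous. [folklore] -/
theorem continuous_Bterm (w : Phase N) (t₀ : ℝ) : Continuous (Function.uncurry (Bterm σ c η₀ η₁ r φ w t₀)) :=
  ((contDiff_Hhat hE hη hη₁ hσ hc).continuous.comp (continuous_U_flight hr w t₀)).mul
    (continuous_uncurry_deriv_of_smooth hφ)

omit hE hη hη₁ hσ hc hφ in
include hr in
/-- The contracted kernel derivative is bounded and measurable. [folklore] -/
theorem kker_bdd_meas (v : V3) : Measurable (kker r v) ∧ ∀ z, |kker r v z| ≤ coneLip r * ‖v‖ :=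
  ⟨(ContinuousLinearMap.apply ℝ ℝ v).measurable.comp (Torus.measurable_torusFderiv _),
    fun z => abs_fderiv_cone_le hr z v⟩

include hE hη hη₁ hσ hc hr hφ in
/-- **Continuity of the streaming derivative along every free flight** (the second streaming hypothesis of
the weak balance law). [folklore] -/
theorem continuous_obsD_freeFlight (w : Phase N) (t₀ : ℝ) :
    Continuous fun t => obsD σ c η₀ η₁ r φ t (freeFlight (Torus.geometry (Fin 3)) (t - t₀) w) := by
  have hAc := fun i => continuous_Aterm hE hη hη₁ hσ hc hr hφ w t₀ i
  have hBc := continuous_Bterm hE hη hη₁ hσ hc hr hφ w t₀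
  have hκ := fun i : Fin (N + 1) => kker_bdd_meas hr (w i).2
  have hpi : ∀ i : Fin (N + 1), Continuous fun t : ℝ => (w i).1 + Torus.proj ((t - t₀) • (w i).2) := fun i =>
    continuous_const.add (Torus.continuous_proj.comp ((continuous_id.sub continuous_const).smul continuous_const))
  have hIA : ∀ i t, Integrable fun x => Aterm σ c η₀ η₁ r φ w t₀ i t x
      * kker r (w i).2 ((w i).1 + Torus.proj ((t - t₀) • (w i).2) - x) := fun i t =>
    integrable_continuous_mul ((hAc i).uncurry_left t)
      ((hκ i).1.comp (measurable_const.sub measurable_id)) fun x => (hκ i).2 _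
  have hIB : ∀ t, Integrable (Bterm σ c η₀ η₁ r φ w t₀ t) := fun t =>
    integrable_of_continuous_T3 (hBc.uncurry_left t)
  have heq : (fun t => obsD σ c η₀ η₁ r φ t (freeFlight (Torus.geometry (Fin 3)) (t - t₀) w)) =
      fun t => (∑ i, ∫ x, Aterm σ c η₀ η₁ r φ w t₀ i t x
        * kker r (w i).2 ((w i).1 + Torus.proj ((t - t₀) • (w i).2) - x)) + ∫ x, Bterm σ c η₀ η₁ r φ w t₀ t x := by
    funext t
    unfold obsD
    simp_rw [obsDi_flight_eq]
    rw [integral_add (integrable_finsetSum _ fun i _ => hIA i t) (hIB t), integral_finsetSum _ fun i _ => hIA i t]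
  rw [heq]
  refine (continuous_finsetSum _ fun i _ => ?_).add (continuous_integral_of_uncurry hBc)
  exact continuous_integral_mul_kernel (hAc i) (hpi i) (hκ i).1 (hκ i).2

end FlightContinuity

/-! ## The observable on the regular range -/

/-- The temperature of the conserved variables is the coarse temperature. [folklore] -/
theorem thetaOf_U (r : ℝ) (w : Phase N) (x : T3) :
    thetaOf (rhoC r w x) (kinC r w x) (WithLp.ofLp (momC r w x)) = thetaC r w x := by
  rw [thetaOf, thetaC_eq]

section RegularConfig

variable {σ r c η₁ η₀ : ℝ} (hη₁ : η₁ < η₀) (hc : 0 < c) {w : Phase N}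
  (hreg : ∀ x, c ≤ rhoC r w x ∧ rhoC r w x * σ ^ 3 ≤ η₁ ∧ c ≤ thetaC r w x)

include hη₁ hc hreg in
/-- On the regular range the modified entropy density of the conserved fields is the crux's entropy density.
[folklore] -/
theorem Hhat_U_eq_Hs (x : T3) : Hhat σ c η₀ η₁ (U r w x) = Hs σ (rhoC r w x) (thetaC r w x) := by
  have hmem : U r w x ∈ regNbhd σ c η₀ η₁ := by
    refine mem_regNbhd_of_regular hη₁ hc (hreg x).1 ?_ (hreg x).2.1
    show c ≤ thetaOf (rhoC r w x) (kinC r w x) (WithLp.ofLp (momC r w x))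
    rw [thetaOf_U]; exact (hreg x).2.2
  rw [Hhat_eq_Hsm hη₁ hc hmem]
  show Hsm σ (rhoC r w x) (thetaOf (rhoC r w x) (kinC r w x) (WithLp.ofLp (momC r w x))) = _
  rw [thetaOf_U, Hs_eq_Hsm (hc.trans_le (hreg x).1) (hc.trans_le (hreg x).2.2)]

include hη₁ hc hreg in
/-- On the regular range the observable is the entropy pairing `∫ H(ρ_r, θ_r) φ(s, ·)`. [folklore] -/
theorem obs_eq (φ : ℝ → T3 → ℝ) (s : ℝ) :
    obs σ c η₀ η₁ r φ s w = ∫ x, Hs σ (rhoC r w x) (thetaC r w x) * φ s x := by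
  unfold obs
  refine integral_congr_ae (Filter.Eventually.of_forall fun x => ?_)
  show Hhat σ c η₀ η₁ (U r w x) * φ s x = Hs σ (rhoC r w x) (thetaC r w x) * φ s x
  rw [Hhat_U_eq_Hs hη₁ hc hreg]

end RegularConfig

end L

/-- **Registered sub-goal `ledgerL_obsCont`** of stub `stub_ledger` (line `exact-entropy-ledger-three-passivities`):
The streaming derivative is continuous along every free flight (second hypothesis of the weak balance law). [folklore] -/
theorem ledgerL_obsCont :
  ∀ {N : ℕ} {σ c η₀ η₁ r : ℝ} {F : ℝ → ℝ}, EosBand η₀ F → 0 < η₁ → η₁ < η₀ → 0 < σ → 0 < c → 0 < r → ∀ {φ : ℝ → T3 → ℝ}, Literature.Analysis.FunctionSpaces.Torus.IsSmoothSpaceTimeOn Set.univ φ → ∀ (w : Phase N) (t₀ : ℝ), Continuous fun t => L.obsD σ c η₀ η₁ r φ t (freeFlight (Torus.geometry (Fin 3)) (t - t₀) w) := by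
  intro N σ c η₀ η₁ r F hE hη hη₁ hσ hc hr φ hφ w t₀
  exact L.continuous_obsD_freeFlight hE hη hη₁ hσ hc hr hφ w t₀

end Summit.AtomisticToContinuum.HydrodynamicLimit.Theorems.LocalSecondLawLedger

end
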